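import Summits.Parity.GeneralizedHardyLittlewood.Theorems.FordMaynardSieveConst01651SieveConst01651Dim5Check
import Summits.Parity.GeneralizedHardyLittlewood.Theorems.FordMaynardSieveConst01651SieveConst01651TypeData
import Summits.Parity.GeneralizedHardyLittlewood.Theorems.FordMaynardSieveConst01651SieveConst01651CoupleEval
import HarnessLib

/-!
# Route `FordMaynardSieveConst01651`, target `SieveConst01651` (stmt-Parity-19185), stub `stub_coneCertClosed`,
# residue `h5`: the generic couple sum is the type value (piece S5 of the checker soundness)

Def-free helper file.  At a generic point `x ∈ ℋ₅` the couple sum `∑_{|A|=2} (coneCert₂(x_A) + coneCert₃(x_{Aᶜ}))` equals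
`typeVal(cellIdx x₀, …, cellIdx x₄; bands) / 10⁶` (`coupleSum_eq_typeVal`), where the band `b_{ij} ∈ {0,1,2}` of each pair is
specified by `xᵢ + xⱼ < c₀` / `c₀ < · < 1/2` / `> 1/2`.  Per couple (`couple_term`) this is `…CoupleEval.couple_eval_generic`
with the increasing enumerations of `A = {i,j}` and `Aᶜ` made explicit (`Finset.orderEmbOfFin_unique`) and the table bridges
`g2Fast = g2Lookup`, `g3Fast = g3Lookup` taken as hypotheses `hg2`, `hg3` (discharged in `…Dim5Final`).  Also the small real-side
rule lemmas of the assembly: `band_exists`, `band_le_two`, `band_mono` (rule M), `bandAllowed_of_real` (rule R2/S), `edgeNum_cast`.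

References: [FordMaynard2024PrimeSieves] arXiv:2407.14368, Theorem 7.3 (a), §8.2.
-/

noncomputable section

open Finset
open scoped Classical
open Literature.NumberTheory.Sieve Literature.NumberTheory.Sieve.FordMaynard

namespace Summit.Parity.GeneralizedHardyLittlewood.FordMaynardSieveConst01651SieveConst01651

/-- One complementary couple of the generic couple sum, read off the type: for `A = {i, j}` (`i < j`) with complement
`{p, q, r}` (`p < q < r`) and pair band `b`, the couple equals `coupleVal (cellIdx xᵢ) (cellIdx xⱼ) b (g3Fast …) / 10⁶`.
[cite: FordMaynard2024PrimeSieves, Theorem 7.3 (a), §8.2] -/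
theorem couple_term (hg2 : ∀ a b j, g2Fast a b j = g2Lookup a b j) (hg3 : ∀ a b c, g3Fast a b c = g3Lookup a b c)
    (x : Fin 5 → ℝ) (hx : Monotone x)
    (hsum : ∑ i, x i = 1) (hopen : ∀ i, x i ∈ openSmall)
    (hpair : ∀ i j, i < j → x i + x j ≠ 8349 / 20000 ∧ x i + x j ≠ 1 / 2)
    (A : Finset (Fin 5)) (hA : A.card = 2) (hAc : Aᶜ.card = 3) (i j p q r : Fin 5)
    (he0 : A.orderEmbOfFin hA 0 = i) (he1 : A.orderEmbOfFin hA 1 = j)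
    (hf0 : Aᶜ.orderEmbOfFin hAc 0 = p) (hf1 : Aᶜ.orderEmbOfFin hAc 1 = q) (hf2 : Aᶜ.orderEmbOfFin hAc 2 = r)
    (b : ℕ) (hs : (b = 0 ∧ x i + x j < 8349 / 20000) ∨ (b = 1 ∧ 8349 / 20000 < x i + x j ∧ x i + x j < 1 / 2) ∨
      (b = 2 ∧ 1 / 2 < x i + x j)) :
    coneCert A.card (fun t => x (A.orderEmbOfFin rfl t)) + coneCert Aᶜ.card (fun t => x (Aᶜ.orderEmbOfFin rfl t)) =
      ((coupleVal (cellIdx (x i)) (cellIdx (x j)) b (g3Fast (cellIdx (x p)) (cellIdx (x q)) (cellIdx (x r))) : ℤ) : ℝ) /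
        1000000 := by
  rw [← apply_orderEmb_cast' coneCert x A hA, ← apply_orderEmb_cast' coneCert x Aᶜ hAc]
  have h := couple_eval_generic x hx hsum hopen hpair A hA hAc
  rw [he0, he1, hf0, hf1, hf2] at h
  rw [h]
  unfold coupleVal
  rcases hs with ⟨rfl, s⟩ | ⟨rfl, s, s'⟩ | ⟨rfl, s⟩
  · have hb : bandIdx (x i + x j) = 0 := (bandIdx_eq_zero_iff (x i + x j)).1.2 s
    rw [if_pos (by linarith), hb, if_pos (Nat.zero_le 1), hg2]
  · have hb : bandIdx (x i + x j) = 1 :=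
      (bandIdx_eq_zero_iff (x i + x j)).2 (fun h0 => by
        have := ((bandIdx_eq_zero_iff (x i + x j)).1).1 h0; linarith)
    rw [if_pos s', hb, if_pos le_rfl, hg2]
  · rw [if_neg (by linarith), if_neg (by norm_num), hg3]

/-- The ten 2-subsets of `Fin 5`. [folklore] -/
theorem filter_card_two_fin5 : (Finset.univ : Finset (Finset (Fin 5))).filter (fun A => A.card = 2) =
    {{0, 1}, {0, 2}, {0, 3}, {0, 4}, {1, 2}, {1, 3}, {1, 4}, {2, 3}, {2, 4}, {3, 4}} := by decide

/-- **The generic couple sum is `typeVal / 10⁶`** of the point's type (cells `cellIdx xₖ`, pair bands `b` as specified).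
[cite: FordMaynard2024PrimeSieves, Theorem 7.3 (a), §8.2] -/
theorem coupleSum_eq_typeVal (hg2 : ∀ a b j, g2Fast a b j = g2Lookup a b j) (hg3 : ∀ a b c, g3Fast a b c = g3Lookup a b c)
    (x : Fin 5 → ℝ) (hx : Monotone x)
    (hsum : ∑ i, x i = 1) (hopen : ∀ i, x i ∈ openSmall)
    (hpair : ∀ i j, i < j → x i + x j ≠ 8349 / 20000 ∧ x i + x j ≠ 1 / 2)
    (b01 b02 b03 b04 b12 b13 b14 b23 b24 b34 : ℕ)
    (hs01 : (b01 = 0 ∧ x 0 + x 1 < 8349 / 20000) ∨ (b01 = 1 ∧ 8349 / 20000 < x 0 + x 1 ∧ x 0 + x 1 < 1 / 2) ∨ (b01 = 2 ∧ 1 / 2 < x 0 + x 1))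
    (hs02 : (b02 = 0 ∧ x 0 + x 2 < 8349 / 20000) ∨ (b02 = 1 ∧ 8349 / 20000 < x 0 + x 2 ∧ x 0 + x 2 < 1 / 2) ∨ (b02 = 2 ∧ 1 / 2 < x 0 + x 2))
    (hs03 : (b03 = 0 ∧ x 0 + x 3 < 8349 / 20000) ∨ (b03 = 1 ∧ 8349 / 20000 < x 0 + x 3 ∧ x 0 + x 3 < 1 / 2) ∨ (b03 = 2 ∧ 1 / 2 < x 0 + x 3))
    (hs04 : (b04 = 0 ∧ x 0 + x 4 < 8349 / 20000) ∨ (b04 = 1 ∧ 8349 / 20000 < x 0 + x 4 ∧ x 0 + x 4 < 1 / 2) ∨ (b04 = 2 ∧ 1 / 2 < x 0 + x 4))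
    (hs12 : (b12 = 0 ∧ x 1 + x 2 < 8349 / 20000) ∨ (b12 = 1 ∧ 8349 / 20000 < x 1 + x 2 ∧ x 1 + x 2 < 1 / 2) ∨ (b12 = 2 ∧ 1 / 2 < x 1 + x 2))
    (hs13 : (b13 = 0 ∧ x 1 + x 3 < 8349 / 20000) ∨ (b13 = 1 ∧ 8349 / 20000 < x 1 + x 3 ∧ x 1 + x 3 < 1 / 2) ∨ (b13 = 2 ∧ 1 / 2 < x 1 + x 3))
    (hs14 : (b14 = 0 ∧ x 1 + x 4 < 8349 / 20000) ∨ (b14 = 1 ∧ 8349 / 20000 < x 1 + x 4 ∧ x 1 + x 4 < 1 / 2) ∨ (b14 = 2 ∧ 1 / 2 < x 1 + x 4))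
    (hs23 : (b23 = 0 ∧ x 2 + x 3 < 8349 / 20000) ∨ (b23 = 1 ∧ 8349 / 20000 < x 2 + x 3 ∧ x 2 + x 3 < 1 / 2) ∨ (b23 = 2 ∧ 1 / 2 < x 2 + x 3))
    (hs24 : (b24 = 0 ∧ x 2 + x 4 < 8349 / 20000) ∨ (b24 = 1 ∧ 8349 / 20000 < x 2 + x 4 ∧ x 2 + x 4 < 1 / 2) ∨ (b24 = 2 ∧ 1 / 2 < x 2 + x 4))
    (hs34 : (b34 = 0 ∧ x 3 + x 4 < 8349 / 20000) ∨ (b34 = 1 ∧ 8349 / 20000 < x 3 + x 4 ∧ x 3 + x 4 < 1 / 2) ∨ (b34 = 2 ∧ 1 / 2 < x 3 + x 4)) :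
    ∑ A ∈ (Finset.univ : Finset (Finset (Fin 5))).filter (fun A => A.card = 2),
        (coneCert A.card (fun i => x (A.orderEmbOfFin rfl i)) +
          coneCert Aᶜ.card (fun i => x (Aᶜ.orderEmbOfFin rfl i))) =
      ((typeVal (cellIdx (x 0)) (cellIdx (x 1)) (cellIdx (x 2)) (cellIdx (x 3)) (cellIdx (x 4))
          b01 b02 b03 b04 b12 b13 b14 b23 b24 b34 : ℤ) : ℝ) / 1000000 := by
  have hA0 : ({0, 1} : Finset (Fin 5)).card = 2 := by decide
  have hAc0 : ({0, 1} : Finset (Fin 5))ᶜ.card = 3 := by decide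
  have u0 := Finset.orderEmbOfFin_unique hA0 (f := ![(0 : Fin 5), 1]) (by decide)
    ((Fin.strictMono_iff_lt_succ (f := ![(0 : Fin 5), 1])).2 (by decide))
  have v0 := Finset.orderEmbOfFin_unique hAc0 (f := ![(2 : Fin 5), 3, 4]) (by decide)
    ((Fin.strictMono_iff_lt_succ (f := ![(2 : Fin 5), 3, 4])).2 (by decide))
  have t0 := couple_term hg2 hg3 x hx hsum hopen hpair ({0, 1} : Finset (Fin 5)) hA0 hAc0 0 1 2 3 4
    (by rw [← u0]; rfl) (by rw [← u0]; rfl) (by rw [← v0]; rfl) (by rw [← v0]; rfl) (by rw [← v0]; rfl) b01 hs01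
  have hA1 : ({0, 2} : Finset (Fin 5)).card = 2 := by decide
  have hAc1 : ({0, 2} : Finset (Fin 5))ᶜ.card = 3 := by decide
  have u1 := Finset.orderEmbOfFin_unique hA1 (f := ![(0 : Fin 5), 2]) (by decide)
    ((Fin.strictMono_iff_lt_succ (f := ![(0 : Fin 5), 2])).2 (by decide))
  have v1 := Finset.orderEmbOfFin_unique hAc1 (f := ![(1 : Fin 5), 3, 4]) (by decide)
    ((Fin.strictMono_iff_lt_succ (f := ![(1 : Fin 5), 3, 4])).2 (by decide))
  have t1 := couple_term hg2 hg3 x hx hsum hopen hpair ({0, 2} : Finset (Fin 5)) hA1 hAc1 0 2 1 3 4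
    (by rw [← u1]; rfl) (by rw [← u1]; rfl) (by rw [← v1]; rfl) (by rw [← v1]; rfl) (by rw [← v1]; rfl) b02 hs02
  have hA2 : ({0, 3} : Finset (Fin 5)).card = 2 := by decide
  have hAc2 : ({0, 3} : Finset (Fin 5))ᶜ.card = 3 := by decide
  have u2 := Finset.orderEmbOfFin_unique hA2 (f := ![(0 : Fin 5), 3]) (by decide)
    ((Fin.strictMono_iff_lt_succ (f := ![(0 : Fin 5), 3])).2 (by decide))
  have v2 := Finset.orderEmbOfFin_unique hAc2 (f := ![(1 : Fin 5), 2, 4]) (by decide)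
    ((Fin.strictMono_iff_lt_succ (f := ![(1 : Fin 5), 2, 4])).2 (by decide))
  have t2 := couple_term hg2 hg3 x hx hsum hopen hpair ({0, 3} : Finset (Fin 5)) hA2 hAc2 0 3 1 2 4
    (by rw [← u2]; rfl) (by rw [← u2]; rfl) (by rw [← v2]; rfl) (by rw [← v2]; rfl) (by rw [← v2]; rfl) b03 hs03
  have hA3 : ({0, 4} : Finset (Fin 5)).card = 2 := by decide
  have hAc3 : ({0, 4} : Finset (Fin 5))ᶜ.card = 3 := by decide
  have u3 := Finset.orderEmbOfFin_unique hA3 (f := ![(0 : Fin 5), 4]) (by decide)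
    ((Fin.strictMono_iff_lt_succ (f := ![(0 : Fin 5), 4])).2 (by decide))
  have v3 := Finset.orderEmbOfFin_unique hAc3 (f := ![(1 : Fin 5), 2, 3]) (by decide)
    ((Fin.strictMono_iff_lt_succ (f := ![(1 : Fin 5), 2, 3])).2 (by decide))
  have t3 := couple_term hg2 hg3 x hx hsum hopen hpair ({0, 4} : Finset (Fin 5)) hA3 hAc3 0 4 1 2 3
    (by rw [← u3]; rfl) (by rw [← u3]; rfl) (by rw [← v3]; rfl) (by rw [← v3]; rfl) (by rw [← v3]; rfl) b04 hs04
  have hA4 : ({1, 2} : Finset (Fin 5)).card = 2 := by decide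
  have hAc4 : ({1, 2} : Finset (Fin 5))ᶜ.card = 3 := by decide
  have u4 := Finset.orderEmbOfFin_unique hA4 (f := ![(1 : Fin 5), 2]) (by decide)
    ((Fin.strictMono_iff_lt_succ (f := ![(1 : Fin 5), 2])).2 (by decide))
  have v4 := Finset.orderEmbOfFin_unique hAc4 (f := ![(0 : Fin 5), 3, 4]) (by decide)
    ((Fin.strictMono_iff_lt_succ (f := ![(0 : Fin 5), 3, 4])).2 (by decide))
  have t4 := couple_term hg2 hg3 x hx hsum hopen hpair ({1, 2} : Finset (Fin 5)) hA4 hAc4 1 2 0 3 4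
    (by rw [← u4]; rfl) (by rw [← u4]; rfl) (by rw [← v4]; rfl) (by rw [← v4]; rfl) (by rw [← v4]; rfl) b12 hs12
  have hA5 : ({1, 3} : Finset (Fin 5)).card = 2 := by decide
  have hAc5 : ({1, 3} : Finset (Fin 5))ᶜ.card = 3 := by decide
  have u5 := Finset.orderEmbOfFin_unique hA5 (f := ![(1 : Fin 5), 3]) (by decide)
    ((Fin.strictMono_iff_lt_succ (f := ![(1 : Fin 5), 3])).2 (by decide))
  have v5 := Finset.orderEmbOfFin_unique hAc5 (f := ![(0 : Fin 5), 2, 4]) (by decide)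
    ((Fin.strictMono_iff_lt_succ (f := ![(0 : Fin 5), 2, 4])).2 (by decide))
  have t5 := couple_term hg2 hg3 x hx hsum hopen hpair ({1, 3} : Finset (Fin 5)) hA5 hAc5 1 3 0 2 4
    (by rw [← u5]; rfl) (by rw [← u5]; rfl) (by rw [← v5]; rfl) (by rw [← v5]; rfl) (by rw [← v5]; rfl) b13 hs13
  have hA6 : ({1, 4} : Finset (Fin 5)).card = 2 := by decide
  have hAc6 : ({1, 4} : Finset (Fin 5))ᶜ.card = 3 := by decide
  have u6 := Finset.orderEmbOfFin_unique hA6 (f := ![(1 : Fin 5), 4]) (by decide)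
    ((Fin.strictMono_iff_lt_succ (f := ![(1 : Fin 5), 4])).2 (by decide))
  have v6 := Finset.orderEmbOfFin_unique hAc6 (f := ![(0 : Fin 5), 2, 3]) (by decide)
    ((Fin.strictMono_iff_lt_succ (f := ![(0 : Fin 5), 2, 3])).2 (by decide))
  have t6 := couple_term hg2 hg3 x hx hsum hopen hpair ({1, 4} : Finset (Fin 5)) hA6 hAc6 1 4 0 2 3
    (by rw [← u6]; rfl) (by rw [← u6]; rfl) (by rw [← v6]; rfl) (by rw [← v6]; rfl) (by rw [← v6]; rfl) b14 hs14
  have hA7 : ({2, 3} : Finset (Fin 5)).card = 2 := by decide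
  have hAc7 : ({2, 3} : Finset (Fin 5))ᶜ.card = 3 := by decide
  have u7 := Finset.orderEmbOfFin_unique hA7 (f := ![(2 : Fin 5), 3]) (by decide)
    ((Fin.strictMono_iff_lt_succ (f := ![(2 : Fin 5), 3])).2 (by decide))
  have v7 := Finset.orderEmbOfFin_unique hAc7 (f := ![(0 : Fin 5), 1, 4]) (by decide)
    ((Fin.strictMono_iff_lt_succ (f := ![(0 : Fin 5), 1, 4])).2 (by decide))
  have t7 := couple_term hg2 hg3 x hx hsum hopen hpair ({2, 3} : Finset (Fin 5)) hA7 hAc7 2 3 0 1 4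
    (by rw [← u7]; rfl) (by rw [← u7]; rfl) (by rw [← v7]; rfl) (by rw [← v7]; rfl) (by rw [← v7]; rfl) b23 hs23
  have hA8 : ({2, 4} : Finset (Fin 5)).card = 2 := by decide
  have hAc8 : ({2, 4} : Finset (Fin 5))ᶜ.card = 3 := by decide
  have u8 := Finset.orderEmbOfFin_unique hA8 (f := ![(2 : Fin 5), 4]) (by decide)
    ((Fin.strictMono_iff_lt_succ (f := ![(2 : Fin 5), 4])).2 (by decide))
  have v8 := Finset.orderEmbOfFin_unique hAc8 (f := ![(0 : Fin 5), 1, 3]) (by decide)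
    ((Fin.strictMono_iff_lt_succ (f := ![(0 : Fin 5), 1, 3])).2 (by decide))
  have t8 := couple_term hg2 hg3 x hx hsum hopen hpair ({2, 4} : Finset (Fin 5)) hA8 hAc8 2 4 0 1 3
    (by rw [← u8]; rfl) (by rw [← u8]; rfl) (by rw [← v8]; rfl) (by rw [← v8]; rfl) (by rw [← v8]; rfl) b24 hs24
  have hA9 : ({3, 4} : Finset (Fin 5)).card = 2 := by decide
  have hAc9 : ({3, 4} : Finset (Fin 5))ᶜ.card = 3 := by decide
  have u9 := Finset.orderEmbOfFin_unique hA9 (f := ![(3 : Fin 5), 4]) (by decide)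
    ((Fin.strictMono_iff_lt_succ (f := ![(3 : Fin 5), 4])).2 (by decide))
  have v9 := Finset.orderEmbOfFin_unique hAc9 (f := ![(0 : Fin 5), 1, 2]) (by decide)
    ((Fin.strictMono_iff_lt_succ (f := ![(0 : Fin 5), 1, 2])).2 (by decide))
  have t9 := couple_term hg2 hg3 x hx hsum hopen hpair ({3, 4} : Finset (Fin 5)) hA9 hAc9 3 4 0 1 2
    (by rw [← u9]; rfl) (by rw [← u9]; rfl) (by rw [← v9]; rfl) (by rw [← v9]; rfl) (by rw [← v9]; rfl) b34 hs34
  rw [filter_card_two_fin5]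
  rw [Finset.sum_insert (by decide)]
  rw [Finset.sum_insert (by decide)]
  rw [Finset.sum_insert (by decide)]
  rw [Finset.sum_insert (by decide)]
  rw [Finset.sum_insert (by decide)]
  rw [Finset.sum_insert (by decide)]
  rw [Finset.sum_insert (by decide)]
  rw [Finset.sum_insert (by decide)]
  rw [Finset.sum_insert (by decide)]
  rw [Finset.sum_singleton, t0, t1, t2, t3, t4, t5, t6, t7, t8, t9]
  unfold typeVal
  push_cast
  ring


/-- Every generic pair sum has a band `b ∈ {0,1,2}` in the specified sense. [folklore] -/
theorem band_exists (s : ℝ) (h1 : s ≠ 8349 / 20000) (h2 : s ≠ 1 / 2) :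
    ∃ b : ℕ, (b = 0 ∧ s < 8349 / 20000) ∨ (b = 1 ∧ 8349 / 20000 < s ∧ s < 1 / 2) ∨ (b = 2 ∧ 1 / 2 < s) := by
  rcases lt_or_gt_of_ne h1 with h | h
  · exact ⟨0, Or.inl ⟨rfl, h⟩⟩
  · rcases lt_or_gt_of_ne h2 with h' | h'
    · exact ⟨1, Or.inr (Or.inl ⟨rfl, h, h'⟩)⟩
    · exact ⟨2, Or.inr (Or.inr ⟨rfl, h'⟩)⟩

/-- Bands are at most `2`. [folklore] -/
theorem band_le_two {s : ℝ} {b : ℕ}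
    (hs : (b = 0 ∧ s < 8349 / 20000) ∨ (b = 1 ∧ 8349 / 20000 < s ∧ s < 1 / 2) ∨ (b = 2 ∧ 1 / 2 < s)) : b ≤ 2 := by
  rcases hs with ⟨rfl, _⟩ | ⟨rfl, _⟩ | ⟨rfl, _⟩ <;> norm_num

/-- Bands are monotone in the pair sum (rule M at a real point). [folklore] -/
theorem band_mono {s s' : ℝ} {b b' : ℕ} (h : s ≤ s')
    (hs : (b = 0 ∧ s < 8349 / 20000) ∨ (b = 1 ∧ 8349 / 20000 < s ∧ s < 1 / 2) ∨ (b = 2 ∧ 1 / 2 < s))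
    (hs' : (b' = 0 ∧ s' < 8349 / 20000) ∨ (b' = 1 ∧ 8349 / 20000 < s' ∧ s' < 1 / 2) ∨ (b' = 2 ∧ 1 / 2 < s')) :
    b ≤ b' := by
  rcases hs with ⟨rfl, h1⟩ | ⟨rfl, h1, h2⟩ | ⟨rfl, h1⟩
  · exact Nat.zero_le _
  · rcases hs' with ⟨rfl, g1⟩ | ⟨rfl, g1, g2⟩ | ⟨rfl, g1⟩
    · linarith
    · exact le_rfl
    · norm_num
  · rcases hs' with ⟨rfl, g1⟩ | ⟨rfl, g1, g2⟩ | ⟨rfl, g1⟩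
    · linarith
    · linarith
    · exact le_rfl

/-- Rule R2/S at a real point: the band of a pair is allowed by the integer edge sums of the pair (`lo, hi`) and of the
complementary triple (`clo, chi`), whose real sums `u`, `v` satisfy `u + v = 1`. [folklore] -/
theorem bandAllowed_of_real {lo hi clo chi b : ℕ} {u v : ℝ} (hlo : (lo : ℝ) < 120000 * u) (hhi : 120000 * u < (hi : ℝ))
    (hclo : (clo : ℝ) < 120000 * v) (hchi : 120000 * v < (chi : ℝ)) (huv : u + v = 1)
    (hs : (b = 0 ∧ u < 8349 / 20000) ∨ (b = 1 ∧ 8349 / 20000 < u ∧ u < 1 / 2) ∨ (b = 2 ∧ 1 / 2 < u)) :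
    bandAllowed lo hi clo chi b = true := by
  unfold bandAllowed
  rcases hs with ⟨rfl, h1⟩ | ⟨rfl, h1, h2⟩ | ⟨rfl, h1⟩
  · have a1 : lo < 50094 := by exact_mod_cast (show (lo : ℝ) < 50094 by linarith)
    have a2 : 69906 < chi := by exact_mod_cast (show (69906 : ℝ) < chi by linarith)
    simp [a1, a2]
  · have a1 : lo < 60000 := by exact_mod_cast (show (lo : ℝ) < 60000 by linarith)
    have a2 : 50094 < hi := by exact_mod_cast (show (50094 : ℝ) < hi by linarith)
    have a3 : clo < 69906 := by exact_mod_cast (show (clo : ℝ) < 69906 by linarith)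
    have a4 : 60000 < chi := by exact_mod_cast (show (60000 : ℝ) < chi by linarith)
    simp [a1, a2, a3, a4]
  · have a1 : 60000 < hi := by exact_mod_cast (show (60000 : ℝ) < hi by linarith)
    have a2 : clo < 60000 := by exact_mod_cast (show (clo : ℝ) < 60000 by linarith)
    simp [a1, a2]

/-- `edgeNum a = 120000 · e_a` over `ℝ`, for `a ≤ 85`. [folklore] -/
theorem edgeNum_cast {a : ℕ} (ha : a ≤ 85) : ((edgeNum a : ℕ) : ℝ) = 120000 * ((certEdge a : ℚ) : ℝ) := by
  by_cases h72 : a ≤ 72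
  · rw [certEdge_cast_of_le h72]
    unfold edgeNum
    rw [if_pos h72]
    push_cast
    ring
  · by_cases h84 : a ≤ 84
    · rw [certEdge_cast_of_ge (by omega) h84]
      unfold edgeNum
      rw [if_neg h72, if_pos h84]
      push_cast [Nat.cast_sub (show 72 ≤ a by omega)]
      ring
    · have h85 : a = 85 := by omega
      subst h85
      unfold edgeNum certEdge
      norm_num


end Summit.Parity.GeneralizedHardyLittlewood.FordMaynardSieveConst01651SieveConst01651

end
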